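import Literature.MathematicalPhysics.QuantumFieldTheory.ConformalBootstrap3D.HRCoeffCellBounds

/-!
# `Δ`-cell bounds for the Hogervorst–Rychkov coefficients by interval recursion

`HRCoeffCellBounds` bounds `A_{n,j}(Δ)` (`hrCoeff Δ ℓ n j`, the recursion (3.9) of
Hogervorst–Rychkov 2013) on a cell `[Δ₁, Δ₂]` by two endpoint evaluations and the pivot-product
ratio, using monotonicity of the pivot-cleared numerators on the CLOSED region `Δ ≥ ℓ + 1`. At
`ℓ = 0` that region starts at `1`, not at the unitarity bound `1/2`, and the monotonicity is false
on `(1/2, 1)` (`A_{2,0} = Δ(Δ-1)²/(24(Δ-1/2))` decreases there: the factor `γ⁻_{Δ+1,1} = (Δ-1)²/3`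
of the step `(1,1) → (2,0)`). A certificate for a box with `Δ_ε < 1` (the lower band
`Δ_ε ∈ [0.6, 0.95]` of the production window, pub-ising3d REFEREE F61) needs `Δ`-uniform
coefficient bounds on such cells.

This file gives them for EVERY cell strictly above the unitarity bound, by running the recursion in
interval arithmetic: `γ⁺_{E,j} = (E+j)²(j+1)/(2j+1)` and `γ⁻_{E,j} = (E-j-1)² j/(2j+1)` are squares
of affine functions of `Δ` times non-negative constants, so on `E ∈ [E₁, E₂]` they lie between
`sqLower`/`sqUpper` of the affine range (`hrGammaPlusLo/Hi`, `hrGammaMinusLo/Hi`); the pivot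
`C_{Δ+n,j} - C_{Δ,ℓ}` is non-decreasing in `Δ` and positive on the descendant range above the bound
(`casimirPivot3D_mono`, `casimirPivot3D_pos`). Hence the LOWER table `hrCoeffLo Δ₁ Δ₂ ℓ` (recursion
with the lower `γ`'s, divided by the pivot at `Δ₂`) and the UPPER table `hrCoeffHi Δ₁ Δ₂ ℓ` (upper
`γ`'s, pivot at `Δ₁`), both set to `0` off the descendant range, satisfy
`0 ≤ hrCoeffLo ≤ A_{n,j}(Δ) ≤ hrCoeffHi` for all `Δ ∈ [Δ₁, Δ₂]` once `unitarityBound3D ℓ < Δ₁`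
(`hrCoeff_mem_Icc_interval`). The tables are finite rational computations for rational `Δ₁, Δ₂`
(a checker evaluates the same recursion twice). The slack is the usual dependency loss of interval
arithmetic, one factor `(1 + O(Δ₂ - Δ₁))` per level, comparable to the pivot-product ratio of the
monotone rule; head cells are narrow anyway. [cite: HogervorstRychkov2013, §3 eq. (3.9)]
-/

noncomputable section

namespace Literature.MathematicalPhysics.QuantumFieldTheory.ConformalBootstrap3D

open Finset Set

/-! ### Range of a square over an interval -/

/-- Lower bound of `x²` for `x ∈ [u, v]`: `0` if `u ≤ 0 ≤ v`, else `min(u², v²)`. [folklore] -/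
def sqLower (u v : ℝ) : ℝ := if u ≤ 0 ∧ 0 ≤ v then 0 else min (u ^ 2) (v ^ 2)

/-- Upper bound of `x²` for `x ∈ [u, v]`: `max(u², v²)`. [folklore] -/
def sqUpper (u v : ℝ) : ℝ := max (u ^ 2) (v ^ 2)

/-- [folklore] -/
theorem sqLower_nonneg (u v : ℝ) : 0 ≤ sqLower u v := by
  unfold sqLower
  split_ifs
  · exact le_rfl
  · positivity

/-- [folklore] -/
theorem sqUpper_nonneg (u v : ℝ) : 0 ≤ sqUpper u v :=
  le_max_of_le_left (sq_nonneg u)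

/-- [folklore] -/
theorem sqLower_le_sq {u v x : ℝ} (hu : u ≤ x) (hv : x ≤ v) : sqLower u v ≤ x ^ 2 := by
  unfold sqLower
  split_ifs with h
  · positivity
  · rcases not_and_or.1 h with h' | h'
    · have h0 : 0 < u := lt_of_not_ge h'
      exact (min_le_left _ _).trans (by nlinarith)
    · have h0 : v < 0 := lt_of_not_ge h'
      exact (min_le_right _ _).trans (by nlinarith)

/-- [folklore] -/
theorem sq_le_sqUpper {u v x : ℝ} (hu : u ≤ x) (hv : x ≤ v) : x ^ 2 ≤ sqUpper u v := by
  unfold sqUpper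
  rcases le_or_gt 0 x with hx | hx
  · exact le_trans (by nlinarith) (le_max_right _ _)
  · exact le_trans (by nlinarith) (le_max_left _ _)

/-! ### Enclosures of `γ^±` on a range of levels -/

/-- Lower enclosure of `γ⁺_{E,j} = (E+j)²(j+1)/(2j+1)` for `E ∈ [E₁, E₂]`.
[cite: HogervorstRychkov2013, §3 eq. (3.8)] -/
def hrGammaPlusLo (E₁ E₂ : ℝ) (j : ℕ) : ℝ :=
  sqLower (E₁ + (j : ℝ)) (E₂ + (j : ℝ)) * ((j : ℝ) + 1) / (2 * (j : ℝ) + 1)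

/-- Upper enclosure of `γ⁺_{E,j}` for `E ∈ [E₁, E₂]`. [cite: HogervorstRychkov2013, §3 eq. (3.8)] -/
def hrGammaPlusHi (E₁ E₂ : ℝ) (j : ℕ) : ℝ :=
  sqUpper (E₁ + (j : ℝ)) (E₂ + (j : ℝ)) * ((j : ℝ) + 1) / (2 * (j : ℝ) + 1)

/-- Lower enclosure of `γ⁻_{E,j} = (E-j-1)² j/(2j+1)` for `E ∈ [E₁, E₂]` (`0` when `j + 1 ∈ [E₁, E₂]`).
[cite: HogervorstRychkov2013, §3 eq. (3.8)] -/
def hrGammaMinusLo (E₁ E₂ : ℝ) (j : ℕ) : ℝ :=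
  sqLower (E₁ - (j : ℝ) - 1) (E₂ - (j : ℝ) - 1) * (j : ℝ) / (2 * (j : ℝ) + 1)

/-- Upper enclosure of `γ⁻_{E,j}` for `E ∈ [E₁, E₂]`. [cite: HogervorstRychkov2013, §3 eq. (3.8)] -/
def hrGammaMinusHi (E₁ E₂ : ℝ) (j : ℕ) : ℝ :=
  sqUpper (E₁ - (j : ℝ) - 1) (E₂ - (j : ℝ) - 1) * (j : ℝ) / (2 * (j : ℝ) + 1)

/-- [folklore] -/
theorem hrGammaPlusLo_nonneg (E₁ E₂ : ℝ) (j : ℕ) : 0 ≤ hrGammaPlusLo E₁ E₂ j := by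
  unfold hrGammaPlusLo
  have := sqLower_nonneg (E₁ + (j : ℝ)) (E₂ + (j : ℝ))
  positivity

/-- [folklore] -/
theorem hrGammaMinusLo_nonneg (E₁ E₂ : ℝ) (j : ℕ) : 0 ≤ hrGammaMinusLo E₁ E₂ j := by
  unfold hrGammaMinusLo
  have := sqLower_nonneg (E₁ - (j : ℝ) - 1) (E₂ - (j : ℝ) - 1)
  positivity

/-- `γ⁺lo ≤ γ⁺_{E,j}` on the level range. [cite: HogervorstRychkov2013, §3 eq. (3.8)] -/
theorem hrGammaPlusLo_le {E₁ E E₂ : ℝ} (h1 : E₁ ≤ E) (h2 : E ≤ E₂) (j : ℕ) :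
    hrGammaPlusLo E₁ E₂ j ≤ hrGammaPlus E j := by
  unfold hrGammaPlusLo hrGammaPlus
  exact div_le_div_of_nonneg_right (mul_le_mul_of_nonneg_right
    (sqLower_le_sq (by linarith) (by linarith)) (by positivity)) (by positivity)

/-- `γ⁺_{E,j} ≤ γ⁺hi` on the level range. [cite: HogervorstRychkov2013, §3 eq. (3.8)] -/
theorem hrGammaPlus_le_hi {E₁ E E₂ : ℝ} (h1 : E₁ ≤ E) (h2 : E ≤ E₂) (j : ℕ) :
    hrGammaPlus E j ≤ hrGammaPlusHi E₁ E₂ j := by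
  unfold hrGammaPlusHi hrGammaPlus
  exact div_le_div_of_nonneg_right (mul_le_mul_of_nonneg_right
    (sq_le_sqUpper (by linarith) (by linarith)) (by positivity)) (by positivity)

/-- `γ⁻lo ≤ γ⁻_{E,j}` on the level range. [cite: HogervorstRychkov2013, §3 eq. (3.8)] -/
theorem hrGammaMinusLo_le {E₁ E E₂ : ℝ} (h1 : E₁ ≤ E) (h2 : E ≤ E₂) (j : ℕ) :
    hrGammaMinusLo E₁ E₂ j ≤ hrGammaMinus E j := by
  unfold hrGammaMinusLo hrGammaMinus
  exact div_le_div_of_nonneg_right (mul_le_mul_of_nonneg_right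
    (sqLower_le_sq (by linarith) (by linarith)) (by positivity)) (by positivity)

/-- `γ⁻_{E,j} ≤ γ⁻hi` on the level range. [cite: HogervorstRychkov2013, §3 eq. (3.8)] -/
theorem hrGammaMinus_le_hi {E₁ E E₂ : ℝ} (h1 : E₁ ≤ E) (h2 : E ≤ E₂) (j : ℕ) :
    hrGammaMinus E j ≤ hrGammaMinusHi E₁ E₂ j := by
  unfold hrGammaMinusHi hrGammaMinus
  exact div_le_div_of_nonneg_right (mul_le_mul_of_nonneg_right
    (sq_le_sqUpper (by linarith) (by linarith)) (by positivity)) (by positivity)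

/-! ### The two interval tables -/

/-- **Lower interval table** for `A_{n,j}(Δ)`, `Δ ∈ [Δ₁, Δ₂]`: the Hogervorst–Rychkov recursion with
the lower `γ`-enclosures and the pivot evaluated at `Δ₂`; `0` off the descendant range.
[cite: HogervorstRychkov2013, §3 eq. (3.9)] -/
noncomputable def hrCoeffLo (Δ₁ Δ₂ : ℝ) (ℓ : ℕ) : ℕ → ℕ → ℝ
  | 0, j => if j = ℓ then 1 else 0
  | n + 1, j =>
      if InDescendantRange ℓ (n + 1) j then
        ((if j = 0 then 0 else hrGammaPlusLo (Δ₁ + n) (Δ₂ + n) (j - 1) * hrCoeffLo Δ₁ Δ₂ ℓ n (j - 1)) +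
            hrGammaMinusLo (Δ₁ + n) (Δ₂ + n) (j + 1) * hrCoeffLo Δ₁ Δ₂ ℓ n (j + 1)) /
          casimirPivot3D Δ₂ ℓ (n + 1) j
      else 0

/-- **Upper interval table** for `A_{n,j}(Δ)`, `Δ ∈ [Δ₁, Δ₂]`: the recursion with the upper
`γ`-enclosures and the pivot evaluated at `Δ₁`; `0` off the descendant range.
[cite: HogervorstRychkov2013, §3 eq. (3.9)] -/
noncomputable def hrCoeffHi (Δ₁ Δ₂ : ℝ) (ℓ : ℕ) : ℕ → ℕ → ℝ
  | 0, j => if j = ℓ then 1 else 0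
  | n + 1, j =>
      if InDescendantRange ℓ (n + 1) j then
        ((if j = 0 then 0 else hrGammaPlusHi (Δ₁ + n) (Δ₂ + n) (j - 1) * hrCoeffHi Δ₁ Δ₂ ℓ n (j - 1)) +
            hrGammaMinusHi (Δ₁ + n) (Δ₂ + n) (j + 1) * hrCoeffHi Δ₁ Δ₂ ℓ n (j + 1)) /
          casimirPivot3D Δ₁ ℓ (n + 1) j
      else 0

/-- [folklore] -/
theorem hrCoeffLo_zero (Δ₁ Δ₂ : ℝ) (ℓ j : ℕ) :
    hrCoeffLo Δ₁ Δ₂ ℓ 0 j = if j = ℓ then 1 else 0 := by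
  simp [hrCoeffLo]

/-- [folklore] -/
theorem hrCoeffHi_zero (Δ₁ Δ₂ : ℝ) (ℓ j : ℕ) :
    hrCoeffHi Δ₁ Δ₂ ℓ 0 j = if j = ℓ then 1 else 0 := by
  simp [hrCoeffHi]

/-- [folklore] -/
theorem hrCoeffLo_succ (Δ₁ Δ₂ : ℝ) (ℓ n j : ℕ) :
    hrCoeffLo Δ₁ Δ₂ ℓ (n + 1) j =
      if InDescendantRange ℓ (n + 1) j then
        ((if j = 0 then 0 else hrGammaPlusLo (Δ₁ + n) (Δ₂ + n) (j - 1) * hrCoeffLo Δ₁ Δ₂ ℓ n (j - 1)) +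
            hrGammaMinusLo (Δ₁ + n) (Δ₂ + n) (j + 1) * hrCoeffLo Δ₁ Δ₂ ℓ n (j + 1)) /
          casimirPivot3D Δ₂ ℓ (n + 1) j
      else 0 := by
  rfl

/-- [folklore] -/
theorem hrCoeffHi_succ (Δ₁ Δ₂ : ℝ) (ℓ n j : ℕ) :
    hrCoeffHi Δ₁ Δ₂ ℓ (n + 1) j =
      if InDescendantRange ℓ (n + 1) j then
        ((if j = 0 then 0 else hrGammaPlusHi (Δ₁ + n) (Δ₂ + n) (j - 1) * hrCoeffHi Δ₁ Δ₂ ℓ n (j - 1)) +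
            hrGammaMinusHi (Δ₁ + n) (Δ₂ + n) (j + 1) * hrCoeffHi Δ₁ Δ₂ ℓ n (j + 1)) /
          casimirPivot3D Δ₁ ℓ (n + 1) j
      else 0 := by
  rfl

/-- Product sandwich: `0 ≤ γlo·Lo ≤ γ·A ≤ γhi·Hi` from `0 ≤ γlo ≤ γ ≤ γhi`, `0 ≤ Lo ≤ A ≤ Hi`.
[folklore] -/
theorem mul_sandwich {γlo γ γhi Lo A Hi : ℝ} (hγ0 : 0 ≤ γlo) (hγ1 : γlo ≤ γ) (hγ2 : γ ≤ γhi)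
    (hL0 : 0 ≤ Lo) (hL : Lo ≤ A) (hH : A ≤ Hi) :
    0 ≤ γlo * Lo ∧ γlo * Lo ≤ γ * A ∧ γ * A ≤ γhi * Hi :=
  ⟨mul_nonneg hγ0 hL0, mul_le_mul hγ1 hL hL0 (hγ0.trans hγ1),
    mul_le_mul hγ2 hH (hL0.trans hL) ((hγ0.trans hγ1).trans hγ2)⟩

/-- Quotient sandwich: `0 ≤ Nlo/p₂ ≤ N/p ≤ Nhi/p₁` from `0 ≤ Nlo ≤ N ≤ Nhi`, `0 < p₁ ≤ p ≤ p₂`.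
[folklore] -/
theorem div_sandwich {Nlo N Nhi p₁ p p₂ : ℝ} (hN0 : 0 ≤ Nlo) (hN1 : Nlo ≤ N) (hN2 : N ≤ Nhi)
    (hp : 0 < p₁) (hp1 : p₁ ≤ p) (hp2 : p ≤ p₂) :
    0 ≤ Nlo / p₂ ∧ Nlo / p₂ ≤ N / p ∧ N / p ≤ Nhi / p₁ := by
  have hp' : 0 < p := hp.trans_le hp1
  have hp₂ : 0 < p₂ := hp'.trans_le hp2
  refine ⟨div_nonneg hN0 hp₂.le, ?_, ?_⟩
  · exact (div_le_div_of_nonneg_right hN1 hp₂.le).trans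
      (div_le_div_of_nonneg_left (hN0.trans hN1) hp' hp2)
  · exact (div_le_div_of_nonneg_right hN2 hp'.le).trans
      (div_le_div_of_nonneg_left ((hN0.trans hN1).trans hN2) hp hp1)

/-- **Interval recursion bounds.** Strictly above the unitarity bound, on a cell
`unitarityBound3D ℓ < Δ₁ ≤ Δ ≤ Δ₂`, for all `n, j`:
`0 ≤ hrCoeffLo Δ₁ Δ₂ ℓ n j ≤ A_{n,j}(Δ) ≤ hrCoeffHi Δ₁ Δ₂ ℓ n j`.
Induction on the level: parents sandwiched (off-range parents are `0` in all three tables),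
`γ`-enclosures, pivot `0 < P(Δ₁) ≤ P(Δ) ≤ P(Δ₂)` on the range.
[cite: HogervorstRychkov2013, §3 eq. (3.9)] -/
theorem hrCoeff_mem_Icc_interval {Δ₁ Δ Δ₂ : ℝ} {ℓ : ℕ} (hℓ : unitarityBound3D ℓ < Δ₁)
    (h1 : Δ₁ ≤ Δ) (h2 : Δ ≤ Δ₂) :
    ∀ n j : ℕ, 0 ≤ hrCoeffLo Δ₁ Δ₂ ℓ n j ∧ hrCoeffLo Δ₁ Δ₂ ℓ n j ≤ hrCoeff Δ ℓ n j ∧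
      hrCoeff Δ ℓ n j ≤ hrCoeffHi Δ₁ Δ₂ ℓ n j := by
  have hΔ : unitarityBound3D ℓ < Δ := lt_of_lt_of_le hℓ h1
  intro n
  induction n with
  | zero =>
    intro j
    rw [hrCoeffLo_zero, hrCoeffHi_zero]
    by_cases h : j = ℓ
    · subst h; simp
    · rw [hrCoeff_zero_of_ne Δ h, if_neg h]
      exact ⟨le_rfl, le_rfl, le_rfl⟩
  | succ n ih =>
    intro j
    by_cases hr : InDescendantRange ℓ (n + 1) j
    · rw [hrCoeffLo_succ, hrCoeffHi_succ, if_pos hr, if_pos hr, hrCoeff_succ]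
      have hpiv : 0 < casimirPivot3D Δ₁ ℓ (n + 1) j :=
        casimirPivot3D_pos hℓ (by omega) hr.1 hr.2.1 hr.2.2
      have hp1 := casimirPivot3D_mono h1 ℓ (n + 1) j
      have hp2 := casimirPivot3D_mono h2 ℓ (n + 1) j
      have hE1 : Δ₁ + (n : ℝ) ≤ Δ + n := by linarith
      have hE2 : Δ + (n : ℝ) ≤ Δ₂ + n := by linarith
      -- the `γ⁺` parent term
      have hP : 0 ≤ (if j = 0 then (0 : ℝ) else
            hrGammaPlusLo (Δ₁ + n) (Δ₂ + n) (j - 1) * hrCoeffLo Δ₁ Δ₂ ℓ n (j - 1)) ∧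
          (if j = 0 then (0 : ℝ) else
            hrGammaPlusLo (Δ₁ + n) (Δ₂ + n) (j - 1) * hrCoeffLo Δ₁ Δ₂ ℓ n (j - 1)) ≤
          (if j = 0 then (0 : ℝ) else hrGammaPlus (Δ + n) (j - 1) * hrCoeff Δ ℓ n (j - 1)) ∧
          (if j = 0 then (0 : ℝ) else hrGammaPlus (Δ + n) (j - 1) * hrCoeff Δ ℓ n (j - 1)) ≤
          (if j = 0 then (0 : ℝ) else
            hrGammaPlusHi (Δ₁ + n) (Δ₂ + n) (j - 1) * hrCoeffHi Δ₁ Δ₂ ℓ n (j - 1)) := by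
        by_cases hj0 : j = 0
        · simp only [hj0, if_true]; exact ⟨le_rfl, le_rfl, le_rfl⟩
        · simp only [if_neg hj0]
          obtain ⟨hl0, hl, hh⟩ := ih (j - 1)
          exact mul_sandwich (hrGammaPlusLo_nonneg _ _ _) (hrGammaPlusLo_le hE1 hE2 _)
            (hrGammaPlus_le_hi hE1 hE2 _) hl0 hl hh
      -- the `γ⁻` parent term
      obtain ⟨hm0, hm, hmh⟩ := ih (j + 1)
      have hM := mul_sandwich (hrGammaMinusLo_nonneg _ _ _) (hrGammaMinusLo_le hE1 hE2 (j + 1))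
        (hrGammaMinus_le_hi hE1 hE2 (j + 1)) hm0 hm hmh
      obtain ⟨hP0, hPl, hPh⟩ := hP
      obtain ⟨hM0, hMl, hMh⟩ := hM
      exact div_sandwich (add_nonneg hP0 hM0) (add_le_add hPl hMl) (add_le_add hPh hMh) hpiv hp1 hp2
    · rw [hrCoeffLo_succ, hrCoeffHi_succ, if_neg hr, if_neg hr,
        hrCoeff_eq_zero_of_not_inDescendantRange Δ hr]
      exact ⟨le_rfl, le_rfl, le_rfl⟩

/-- The lower table is non-negative. [cite: HogervorstRychkov2013, §3 eq. (3.9)] -/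
theorem hrCoeffLo_nonneg {Δ₁ Δ₂ : ℝ} {ℓ : ℕ} (hℓ : unitarityBound3D ℓ < Δ₁) (h12 : Δ₁ ≤ Δ₂)
    (n j : ℕ) : 0 ≤ hrCoeffLo Δ₁ Δ₂ ℓ n j :=
  (hrCoeff_mem_Icc_interval hℓ le_rfl h12 n j).1

/-- **Interval cell bounds** as membership: `A_{n,j}(Δ) ∈ [hrCoeffLo, hrCoeffHi]` on
`unitarityBound3D ℓ < Δ₁ ≤ Δ ≤ Δ₂`. [cite: HogervorstRychkov2013, §3 eq. (3.9)] -/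
theorem hrCoeff_mem_Icc_interval' {Δ₁ Δ Δ₂ : ℝ} {ℓ : ℕ} (hℓ : unitarityBound3D ℓ < Δ₁)
    (h1 : Δ₁ ≤ Δ) (h2 : Δ ≤ Δ₂) (n j : ℕ) :
    hrCoeff Δ ℓ n j ∈ Set.Icc (hrCoeffLo Δ₁ Δ₂ ℓ n j) (hrCoeffHi Δ₁ Δ₂ ℓ n j) :=
  ⟨(hrCoeff_mem_Icc_interval hℓ h1 h2 n j).2.1, (hrCoeff_mem_Icc_interval hℓ h1 h2 n j).2.2⟩

/-- Transcription check at level one: for `Δ₁ + ℓ ≥ 0` the tables reproduce the endpoint values of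
`A_{1,ℓ+1} = (Δ+ℓ)²(ℓ+1)/((2ℓ+1)·2(Δ+ℓ))` with crossed pivots:
`hrCoeffLo Δ₁ Δ₂ ℓ 1 (ℓ+1) = γ⁺_{Δ₁,ℓ} / P(Δ₂)`. [cite: HogervorstRychkov2013, §3 eq. (3.10)] -/
theorem hrCoeffLo_one_succ {Δ₁ Δ₂ : ℝ} {ℓ : ℕ} (h0 : 0 ≤ Δ₁ + ℓ) (h12 : Δ₁ ≤ Δ₂) :
    hrCoeffLo Δ₁ Δ₂ ℓ 1 (ℓ + 1) = hrGammaPlus Δ₁ ℓ / casimirPivot3D Δ₂ ℓ 1 (ℓ + 1) := by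
  have hr : InDescendantRange ℓ (0 + 1) (ℓ + 1) := ⟨by omega, by omega, by omega⟩
  rw [show (1 : ℕ) = 0 + 1 from rfl, hrCoeffLo_succ, if_pos hr]
  have hne : ℓ + 1 ≠ 0 := by omega
  rw [if_neg hne, show ℓ + 1 - 1 = ℓ from by omega, hrCoeffLo_zero, hrCoeffLo_zero, if_pos rfl,
    if_neg (by omega : ℓ + 1 + 1 ≠ ℓ)]
  simp only [Nat.cast_zero, add_zero, mul_one, mul_zero]
  congr 1
  unfold hrGammaPlusLo hrGammaPlus sqLower
  have h0' : 0 ≤ Δ₂ + ℓ := by linarith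
  by_cases hz : Δ₁ + ℓ ≤ 0
  · have hz0 : Δ₁ + (ℓ : ℝ) = 0 := le_antisymm hz h0
    rw [if_pos ⟨hz, h0'⟩, hz0]; ring
  · rw [if_neg (fun h => hz h.1), min_eq_left]
    exact pow_le_pow_left₀ h0 (by linarith) 2

end Literature.MathematicalPhysics.QuantumFieldTheory.ConformalBootstrap3D
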